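/-
Copyright: cell `pub-ymgap` (HUMAN RULING D-0062), Track A of `YM-PLAN.md`, DAG node N20 (= NE7b); R134 acceleration seat
`pub-ymgap-dag-n20-c` (strategy s1, generation 3), module 11b.  Released under the licence of the surrounding project.
-/
import Summits.QuantumFields.YangMills.Theorems.BalabanUVNodesN20LCSRestrictedChessboard
import HarnessLib

/-!
# YM-DAG node N20 (= NE7b), strategy s1, module 11b: CUBE ENERGIES — the reflection-covariant family the chessboard of module 11a
# consumes, and the chessboard bound for local exponential moments of plaquette energies in the plaquette-weighted
# (small-field-RESTRICTED) level-0 state of record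

Track A of `YM-PLAN.md` (cell `pub-ymgap`, HUMAN RULING D-0062), node **N20** = spine estimate NE7b (`T4WeightBudget.RelWeightBound` — the
cell `pub-balaban`'s OWN estimate, NOT PRINTED in [Bałaban 1983–89], NOT PROVED).  Seat `pub-ymgap-dag-n20-c` (R134, s1), module 11b (module
11a: `…Theorems.BalabanUVNodesN20LCSRestrictedChessboard`, the chessboard for the weighted level-0 state and any reflection-covariant cube-indexed
family).  Kernel theorems only: 0 `def`, 0 `sorry`, standard axioms; COUNT-NEUTRAL; `--supports` the K3′ item `SpineGivenEndpointR12`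
(stmt-QuantumFields-19908) as a helper.  Nothing of Bałaban's is asserted: the objects are the cell's `Plaq ∕ GaugeField.plaqHol ∕ reTr ∕
Missing.expect ∕ PosHalfSupported ∕ IsPosHalfBond` and the symmetries `Plaq.translate ∕ permute ∕ reflect` of `TorusHypercubicSymmetry`, read BY
NAME; the CUBE ENERGY of the closed unit cube `[c, c+1]^d` (lower corner `c ∈ (ℤ∕N₀)^d`),

  `E_c(U) = Σ_{p ⊂ [c,c+1]^d} (1 − Re tr U(∂p))`,  `p ⊂ [c,c+1]^d :⟺ ∀ κ, x_κ(p) = c_κ ∨ (κ ∉ {μ(p), ν(p)} ∧ x_κ(p) = c_κ + 1)`,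

is written INLINE (no definition is introduced).

WHY.  Module 11a reduces the chessboard ITERATION for the restricted state (located residual (ii)(b) of the seat's `N20-S1-TRIAGE.md` §1) to
three covariance identities, positive-half support and measurability of the observable family; THIS FILE discharges them for the exponential
moments `e^{tE_c}` of the cube energies — the carriers of «LCS-j» (every plaquette lies in the closed cube of its base point, so local plaquette
energies are dominated by cube energies) — and concludes the chessboard bound for them.

WHAT IS PROVED ([folklore]: lattice bookkeeping on the torus `T^{(0)}`):
* §3 `inCube_translate`, `ne_min_and_ne_max_iff`, `inCube_permute`, `inCube_reflect_zero` — membership of a plaquette in a closed unit cube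
  is covariant under translations (`c ↦ c + a`), coordinate permutations (`c ↦ π·c`) and the time reflection `r₀ = Θ'` (`c ↦ c[0 ↦ −1 − c₀]`).
* §4 `cubeEnergy_translate`, `cubeEnergy_permute`, `cubeEnergy_negReflect` (covariance of `E_c`, by re-indexing along `Plaq.translateEquiv ∕
  permuteEquiv ∕ reflectEquiv` and `plaqHol_translate ∕ reTr_plaqHol_permute ∕ reTr_plaqHol_reflect`), `plaqTerm_mem`, `cubeEnergy_mem`
  (`0 ≤ E_c ≤ 2·#plaquettes`), `measurable_cubeEnergy`, `isPosHalfBond_of_inCube` (the four bonds of a plaquette of a time-positive cube,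
  `c₀ < N₀∕2`, are positive-half bonds), ★ `posHalfSupported_cubeEnergy`.
* §5 `expect_mul_prod_mono`, ★★ **`chessboard_exp_cubeEnergy`** — for `β ≥ 0`, a non-negative bounded measurable one-plaquette weight `w`
  with `⟨∏_p w⟩ > 0` (e.g. Bałaban's small-field characteristic function `𝟙[· ≤ ε]`), `t ≥ 0` and every set `S` of cubes:
  `⟨∏_{c∈S} e^{tE_c}·∏_p w⟩∕⟨∏_p w⟩ ≤ (⟨∏_c e^{tE_c}·∏_p w⟩∕⟨∏_p w⟩)^{#S∕N₀^d}` — LOCAL exponential moments of cube energies in the weighted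
  (restricted, normalised) state are bounded by the GLOBAL one to the power volume fraction.

HONEST FRAMING.  One finite torus `T^{(0)}`, `SU(N)`, the bare Wilson weight dressed by a symmetric product of one-plaquette weights; the
junction of the global factor `⟨e^{tΣ_c E_c}∏𝟙⟩∕⟨∏𝟙⟩` with module 10c's restricted action moment (host dictionary of module 7) and the
resulting conditional «LCS-0» inequality are the NEXT module; levels `≥ 1`, residual (i) (seat n20-d), (iv) (A1c) untouched.  NE7b NOT PRINTED ∕
NOT PROVED; (α)-instance 0∕1; N20 NOT discharged; typed 28∕28, discharged count untouched; NOT ℝ⁴, NOT infinite volume, NOT OS axioms, NOT a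
mass gap, NOT Clay.
-/

set_option autoImplicit false

noncomputable section

namespace Summit.QuantumFields.YangMills.BalabanUVNodes.N20LCSRestrictedChessboard

open MeasureTheory Finset
open Literature.MathematicalPhysics.QuantumFieldTheory
open Literature.MathematicalPhysics.QuantumFieldTheory.Balaban1983to89
open Literature.Barriers.CriticalPhenomena.NonGibbs

variable {N : ℕ} [NeZero N]

/-! ## §3 The closed unit cube `[c, c+1]^d` and its plaquettes: membership is covariant under the torus symmetries -/

section Cube

variable {P : Params}

/-- Membership of a plaquette in the closed unit cube with lower corner `c` is TRANSLATION covariant. [folklore] -/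
theorem inCube_translate (c a : BlockIdx P.d (P.sitesPerDir 0)) (p : Plaq P 0) :
    (∀ κ, (p.translate a).src κ = (c + a) κ ∨ (κ ≠ (p.translate a).μ ∧ κ ≠ (p.translate a).ν ∧
        (p.translate a).src κ = (c + a) κ + 1)) ↔
      (∀ κ, p.src κ = c κ ∨ (κ ≠ p.μ ∧ κ ≠ p.ν ∧ p.src κ = c κ + 1)) := by
  refine forall_congr' fun κ => ?_
  show (p.src κ + a κ = c κ + a κ ∨ (κ ≠ p.μ ∧ κ ≠ p.ν ∧ p.src κ + a κ = c κ + a κ + 1)) ↔ _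
  rw [add_left_inj, add_right_comm, add_left_inj]

/-- `a ∉ {min x y, max x y}` iff `a ∉ {x, y}`. [folklore] -/
theorem ne_min_and_ne_max_iff {α : Type*} [LinearOrder α] (a x y : α) : (a ≠ min x y ∧ a ≠ max x y) ↔ (a ≠ x ∧ a ≠ y) := by
  rcases le_total x y with h | h
  · rw [min_eq_left h, max_eq_right h]
  · rw [min_eq_right h, max_eq_left h, and_comm]

/-- Membership in the closed unit cube is covariant under COORDINATE PERMUTATIONS. [folklore] -/
theorem inCube_permute (π : Equiv.Perm (Fin P.d)) (c : BlockIdx P.d (P.sitesPerDir 0)) (p : Plaq P 0) :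
    (∀ κ, (p.permute π).src κ = (Site.permute π c) κ ∨ (κ ≠ (p.permute π).μ ∧ κ ≠ (p.permute π).ν ∧
        (p.permute π).src κ = (Site.permute π c) κ + 1)) ↔
      (∀ κ, p.src κ = c κ ∨ (κ ≠ p.μ ∧ κ ≠ p.ν ∧ p.src κ = c κ + 1)) := by
  rw [Plaq.permute_src, Plaq.permute_μ, Plaq.permute_ν]
  simp only [Site.permute_apply]
  refine ⟨fun h κ => ?_, fun h κ => ?_⟩
  · have h' := h (π κ)
    rw [Equiv.symm_apply_apply] at h'
    refine h'.imp_right fun ⟨h1, h2, h3⟩ => ?_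
    have h12 := (ne_min_and_ne_max_iff _ _ _).1 ⟨h1, h2⟩
    exact ⟨fun e => h12.1 (congrArg π e), fun e => h12.2 (congrArg π e), h3⟩
  · have h' := h (π.symm κ)
    refine h'.imp_right fun ⟨h1, h2, h3⟩ => ?_
    have h12 : κ ≠ π p.μ ∧ κ ≠ π p.ν :=
      ⟨fun e => h1 (by rw [e, Equiv.symm_apply_apply]), fun e => h2 (by rw [e, Equiv.symm_apply_apply])⟩
    exact ⟨((ne_min_and_ne_max_iff _ _ _).2 h12).1, ((ne_min_and_ne_max_iff _ _ _).2 h12).2, h3⟩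

/-- Membership in the closed unit cube is covariant under the TIME REFLECTION `Θ'` (`= r₀`): the plaquette `r₀ p` lies in the cube
with lower corner `θ₀ c = c[0 ↦ −1 − c₀]` iff `p` lies in the cube with lower corner `c`. [folklore] -/
theorem inCube_reflect_zero (c : BlockIdx P.d (P.sitesPerDir 0)) (p : Plaq P 0) :
    (∀ κ, (p.reflect 0).src κ = (Function.update c 0 (-1 - c 0)) κ ∨ (κ ≠ (p.reflect 0).μ ∧ κ ≠ (p.reflect 0).ν ∧
        (p.reflect 0).src κ = (Function.update c 0 (-1 - c 0)) κ + 1)) ↔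
      (∀ κ, p.src κ = c κ ∨ (κ ≠ p.μ ∧ κ ≠ p.ν ∧ p.src κ = c κ + 1)) := by
  have hsrc : ∀ κ, (p.reflect 0).src κ =
      if κ = 0 then (if p.μ = 0 ∨ p.ν = 0 then -(p.src 0 + 1) else -p.src 0) else p.src κ := by
    intro κ
    simp only [Plaq.reflect]
    split_ifs with h1 h2 h2
    · subst h2; rw [Site.reflect_apply, if_pos rfl, Site.shift_apply, if_pos rfl]
    · rw [Site.reflect_apply, if_neg h2, Site.shift_apply, if_neg h2]
    · subst h2; rw [Site.reflect_apply, if_pos rfl]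
    · rw [Site.reflect_apply, if_neg h2]
  have hμ : (p.reflect 0).μ = p.μ := rfl
  have hν : (p.reflect 0).ν = p.ν := rfl
  refine forall_congr' fun κ => ?_
  rw [hsrc κ, hμ, hν]
  by_cases hκ : κ = 0
  · subst hκ
    rw [Function.update_self]
    simp only [if_true]
    by_cases hd : p.μ = 0 ∨ p.ν = 0
    · rw [if_pos hd]
      have hnd : ¬ ((0 : Fin P.d) ≠ p.μ ∧ 0 ≠ p.ν ∧ -(p.src 0 + 1) = -1 - c 0 + 1) := fun h => by
        rcases hd with h' | h' <;> [exact h.1 h'.symm; exact h.2.1 h'.symm]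
      have hnd' : ¬ ((0 : Fin P.d) ≠ p.μ ∧ 0 ≠ p.ν ∧ p.src 0 = c 0 + 1) := fun h => by
        rcases hd with h' | h' <;> [exact h.1 h'.symm; exact h.2.1 h'.symm]
      simp only [hnd, hnd', or_false]
      constructor
      · intro h; linear_combination -h
      · intro h; rw [h]; ring
    · rw [if_neg hd]
      push Not at hd
      simp only [ne_comm (a := (0 : Fin P.d)), hd.1, hd.2, ne_eq, not_false_eq_true, true_and]
      constructor
      · rintro (h | h)
        · right; linear_combination -h
        · left; linear_combination -h
      · rintro (h | h)
        · right; rw [h]; ring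
        · left; rw [h]; ring
  · rw [if_neg hκ, Function.update_of_ne hκ]

end Cube

/-! ## §4 CUBE ENERGIES `E_c(U) = Σ_{p ⊂ [c,c+1]^d} (1 − Re tr U(∂p))`: covariance, bounds, measurability, positive-half support -/

section CubeEnergy

variable {P : Params}

/-- **Cube energies are TRANSLATION covariant**: `E_c(τ_a U) = E_{c+a}(U)`. [folklore] -/
theorem cubeEnergy_translate (a c : BlockIdx P.d (P.sitesPerDir 0)) (U : GaugeField P 0 (Matrix.specialUnitaryGroup (Fin N) ℂ)) :
    (∑ p : Plaq P 0, if (∀ κ, p.src κ = c κ ∨ (κ ≠ p.μ ∧ κ ≠ p.ν ∧ p.src κ = c κ + 1)) then (1 - reTr (GaugeField.plaqHol (U.translate a) p)) else 0) =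
      (∑ p : Plaq P 0, if (∀ κ, p.src κ = (c + a) κ ∨ (κ ≠ p.μ ∧ κ ≠ p.ν ∧ p.src κ = (c + a) κ + 1)) then (1 - reTr (GaugeField.plaqHol U p)) else 0) := by
  simp_rw [GaugeField.plaqHol_translate]
  refine Fintype.sum_equiv (Plaq.translateEquiv a) _ _ fun p => ?_
  exact (if_congr (inCube_translate c a p) rfl rfl).symm

/-- **Cube energies are PERMUTATION covariant**: `E_c(π·U) = E_{π·c}(U)`. [folklore] -/
theorem cubeEnergy_permute (π : Equiv.Perm (Fin P.d)) (c : BlockIdx P.d (P.sitesPerDir 0)) (U : GaugeField P 0 (Matrix.specialUnitaryGroup (Fin N) ℂ)) :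
    (∑ p : Plaq P 0, if (∀ κ, p.src κ = c κ ∨ (κ ≠ p.μ ∧ κ ≠ p.ν ∧ p.src κ = c κ + 1)) then (1 - reTr (GaugeField.plaqHol (U.permute π) p)) else 0) =
      (∑ p : Plaq P 0, if (∀ κ, p.src κ = (Site.permute π c) κ ∨ (κ ≠ p.μ ∧ κ ≠ p.ν ∧ p.src κ = (Site.permute π c) κ + 1)) then (1 - reTr (GaugeField.plaqHol U p)) else 0) := by
  simp_rw [GaugeField.reTr_plaqHol_permute]
  refine Fintype.sum_equiv (Plaq.permuteEquiv π) _ _ fun p => ?_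
  exact (if_congr (inCube_permute π c p) rfl rfl).symm

/-- **Cube energies are covariant under the TIME REFLECTION**: `E_c(Θ'U) = E_{θ₀ c}(U)`, `θ₀ c = c[0 ↦ −1 − c₀]`. [folklore] -/
theorem cubeEnergy_negReflect (c : BlockIdx P.d (P.sitesPerDir 0)) (U : GaugeField P 0 (Matrix.specialUnitaryGroup (Fin N) ℂ)) :
    (∑ p : Plaq P 0, if (∀ κ, p.src κ = c κ ∨ (κ ≠ p.μ ∧ κ ≠ p.ν ∧ p.src κ = c κ + 1)) then (1 - reTr (GaugeField.plaqHol U.negReflect p)) else 0) =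
      (∑ p : Plaq P 0, if (∀ κ, p.src κ = (Function.update c 0 (-1 - c 0)) κ ∨ (κ ≠ p.μ ∧ κ ≠ p.ν ∧ p.src κ = (Function.update c 0 (-1 - c 0)) κ + 1)) then (1 - reTr (GaugeField.plaqHol U p)) else 0) := by
  rw [GaugeField.negReflect_eq_reflect_zero]
  simp_rw [GaugeField.reTr_plaqHol_reflect]
  refine Fintype.sum_equiv (Plaq.reflectEquiv 0) _ _ fun p => ?_
  exact (if_congr (inCube_reflect_zero c p) rfl rfl).symm

/-- One plaquette energy lies in `[0, 2]` (normalised trace, `|Re tr| ≤ 1`). [folklore] -/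
theorem plaqTerm_mem (U : GaugeField P 0 (Matrix.specialUnitaryGroup (Fin N) ℂ)) (p : Plaq P 0) :
    0 ≤ 1 - reTr (GaugeField.plaqHol U p) ∧ 1 - reTr (GaugeField.plaqHol U p) ≤ 2 := by
  have h1 := GaugeGroup.reTr_le_one (GaugeField.plaqHol U p)
  have h2 := (abs_le.1 (RegularGaugeGroup.abs_reTr_le_one (GaugeField.plaqHol U p))).1
  constructor <;> linarith

/-- **Cube energies are non-negative and at most `2·#plaquettes`.** [folklore] -/
theorem cubeEnergy_mem (c : BlockIdx P.d (P.sitesPerDir 0)) (U : GaugeField P 0 (Matrix.specialUnitaryGroup (Fin N) ℂ)) :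
    0 ≤ (∑ p : Plaq P 0, if (∀ κ, p.src κ = c κ ∨ (κ ≠ p.μ ∧ κ ≠ p.ν ∧ p.src κ = c κ + 1)) then (1 - reTr (GaugeField.plaqHol U p)) else 0) ∧
      (∑ p : Plaq P 0, if (∀ κ, p.src κ = c κ ∨ (κ ≠ p.μ ∧ κ ≠ p.ν ∧ p.src κ = c κ + 1)) then (1 - reTr (GaugeField.plaqHol U p)) else 0) ≤ 2 * Fintype.card (Plaq P 0) := by
  constructor
  · refine Finset.sum_nonneg fun p _ => ?_
    split_ifs
    · exact (plaqTerm_mem U p).1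
    · exact le_rfl
  · calc (∑ p : Plaq P 0, if (∀ κ, p.src κ = c κ ∨ (κ ≠ p.μ ∧ κ ≠ p.ν ∧ p.src κ = c κ + 1)) then (1 - reTr (GaugeField.plaqHol U p)) else 0)
        ≤ ∑ _p : Plaq P 0, (2 : ℝ) := Finset.sum_le_sum fun p _ => by
          split_ifs
          · exact (plaqTerm_mem U p).2
          · norm_num
      _ = 2 * Fintype.card (Plaq P 0) := by rw [Finset.sum_const, Finset.card_univ, nsmul_eq_mul, mul_comm]

/-- Cube energies are measurable. [folklore] -/
theorem measurable_cubeEnergy (c : BlockIdx P.d (P.sitesPerDir 0)) :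
    Measurable fun U : GaugeField P 0 (Matrix.specialUnitaryGroup (Fin N) ℂ) => (∑ p : Plaq P 0, if (∀ κ, p.src κ = c κ ∨ (κ ≠ p.μ ∧ κ ≠ p.ν ∧ p.src κ = c κ + 1)) then (1 - reTr (GaugeField.plaqHol U p)) else 0) := by
  refine Finset.measurable_sum _ fun p _ => ?_
  by_cases h : (∀ κ, p.src κ = c κ ∨ (κ ≠ p.μ ∧ κ ≠ p.ν ∧ p.src κ = c κ + 1))
  · simp only [if_pos h]
    exact measurable_const.sub (RegularGaugeGroup.measurable_reTr.comp
      (Missing.measurable_plaqHol (G := Matrix.specialUnitaryGroup (Fin N) ℂ) p))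
  · simp only [if_neg h]
    exact measurable_const

/-- The time coordinates of the bonds of a plaquette of the closed cube `[c, c+1]^d` with `c₀ < N₀∕2` lie in the closed positive-time
half: all four bonds of such a plaquette are positive-half bonds (`IsPosHalfBond`). [folklore] -/
theorem isPosHalfBond_of_inCube {c : BlockIdx P.d (P.sitesPerDir 0)} (hc : (c 0).val < P.sitesPerDir 0 / 2) {p : Plaq P 0}
    (hp : (∀ κ, p.src κ = c κ ∨ (κ ≠ p.μ ∧ κ ≠ p.ν ∧ p.src κ = c κ + 1))) :
    IsPosHalfBond (⟨p.src, p.μ⟩ : PBond P 0) ∧ IsPosHalfBond (⟨p.src.shift p.μ, p.ν⟩ : PBond P 0) ∧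
      IsPosHalfBond (⟨p.src.shift p.ν, p.μ⟩ : PBond P 0) ∧ IsPosHalfBond (⟨p.src, p.ν⟩ : PBond P 0) := by
  have hN2 : P.sitesPerDir 0 / 2 + 1 ≤ P.sitesPerDir 0 := by have := P.one_lt_sitesPerDir 0; omega
  have hν0 : p.ν ≠ 0 := fun h => by have := p.hμν; rw [h] at this; exact (Fin.not_lt_zero _) this
  have h0 := hp 0
  -- `(c₀ + 1).val = c₀.val + 1`
  have hone : (1 : ZMod (P.sitesPerDir 0)).val = 1 := ZMod.val_one _
  have hc1 : (c 0 + 1).val = (c 0).val + 1 := by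
    have hlt : (c 0).val + (1 : ZMod (P.sitesPerDir 0)).val < P.sitesPerDir 0 := by rw [hone]; omega
    rw [ZMod.val_add_of_lt hlt, hone]
  -- the time coordinate of the base point
  have hx_le : (p.src 0).val ≤ P.sitesPerDir 0 / 2 := by
    rcases h0 with h | ⟨-, -, h⟩
    · rw [h]; exact hc.le
    · rw [h, hc1]; omega
  have hx_lt : p.μ = 0 → (p.src 0).val < P.sitesPerDir 0 / 2 := fun hμ => by
    rcases h0 with h | ⟨h1, -, -⟩
    · rw [h]; exact hc
    · exact absurd hμ.symm h1
  have hshiftμ : (p.src.shift p.μ) 0 = if (0 : Fin P.d) = p.μ then p.src p.μ + 1 else p.src 0 := Site.shift_apply _ _ _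
  have hshiftν : (p.src.shift p.ν) 0 = p.src 0 := by rw [Site.shift_apply, if_neg (Ne.symm hν0)]
  refine ⟨?_, ?_, ?_, ?_⟩
  · unfold IsPosHalfBond
    by_cases hμ : p.μ = 0
    · simp only [hμ, if_true]; exact hx_lt hμ
    · simp only [hμ, if_false]; exact hx_le
  · unfold IsPosHalfBond
    simp only [hν0, if_false]
    show ((p.src.shift p.μ) 0).val ≤ _
    rw [hshiftμ]
    by_cases hμ : (0 : Fin P.d) = p.μ
    · rw [if_pos hμ, ← hμ]
      have hx0 : p.src 0 = c 0 := by
        rcases h0 with h | ⟨h1, -, -⟩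
        · exact h
        · exact absurd hμ h1
      rw [hx0, hc1]; omega
    · rw [if_neg hμ]; exact hx_le
  · unfold IsPosHalfBond
    show (if p.μ = 0 then ((p.src.shift p.ν) 0).val < _ else ((p.src.shift p.ν) 0).val ≤ _)
    rw [hshiftν]
    by_cases hμ : p.μ = 0
    · simp only [hμ, if_true]; exact hx_lt hμ
    · simp only [hμ, if_false]; exact hx_le
  · unfold IsPosHalfBond
    simp only [hν0, if_false]
    exact hx_le

/-- **Cube energies of time-positive cubes are positive-half supported.** [folklore] -/
theorem posHalfSupported_cubeEnergy {c : BlockIdx P.d (P.sitesPerDir 0)} (hc : (c 0).val < P.sitesPerDir 0 / 2) :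
    PosHalfSupported fun U : GaugeField P 0 (Matrix.specialUnitaryGroup (Fin N) ℂ) => (∑ p : Plaq P 0, if (∀ κ, p.src κ = c κ ∨ (κ ≠ p.μ ∧ κ ≠ p.ν ∧ p.src κ = c κ + 1)) then (1 - reTr (GaugeField.plaqHol U p)) else 0) := by
  intro U V hUV
  refine Finset.sum_congr rfl fun p _ => ?_
  by_cases hp : (∀ κ, p.src κ = c κ ∨ (κ ≠ p.μ ∧ κ ≠ p.ν ∧ p.src κ = c κ + 1))
  · obtain ⟨h1, h2, h3, h4⟩ := isPosHalfBond_of_inCube hc hp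
    simp only [if_pos hp, GaugeField.plaqHol, hUV _ h1, hUV _ h2, hUV _ h3, hUV _ h4]
  · simp only [if_neg hp]

end CubeEnergy

/-! ## §5 THE CHESSBOARD BOUND FOR EXPONENTIAL MOMENTS OF CUBE ENERGIES in the plaquette-weighted (restricted) level-0 state -/

section Main

/-- Monotonicity of the weighted torus expectation on bounded measurable observables (`β ≥ 0`, `w ≥ 0`). [folklore] -/
theorem expect_mul_prod_mono (P : Params) {β : ℝ} (hβ : 0 ≤ β) {w : ℝ → ℝ} (hw0 : ∀ t, 0 ≤ w t) (hwm : Measurable w)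
    (hwb : ∃ K : ℝ, ∀ t, w t ≤ K) {F G : GaugeField P 0 (Matrix.specialUnitaryGroup (Fin N) ℂ) → ℝ} (hFm : Measurable F)
    (hGm : Measurable G) (hFb : ∃ C : ℝ, ∀ U, |F U| ≤ C) (hGb : ∃ C : ℝ, ∀ U, |G U| ≤ C) (hFG : ∀ U, F U ≤ G U) :
    Missing.expect (G := Matrix.specialUnitaryGroup (Fin N) ℂ) P β (fun U => F U * ∏ p : Plaq P 0, w (1 - reTr (GaugeField.plaqHol U p))) ≤
      Missing.expect (G := Matrix.specialUnitaryGroup (Fin N) ℂ) P β (fun U => G U * ∏ p : Plaq P 0, w (1 - reTr (GaugeField.plaqHol U p))) := by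
  obtain ⟨K, hK⟩ := hwb
  obtain ⟨CF, hCF⟩ := hFb
  obtain ⟨CG, hCG⟩ := hGb
  have hK0 : 0 ≤ K := (hw0 0).trans (hK 0)
  have hWm : Measurable fun U : GaugeField P 0 (Matrix.specialUnitaryGroup (Fin N) ℂ) => ∏ p : Plaq P 0, w (1 - reTr (GaugeField.plaqHol U p)) :=
    Finset.measurable_prod _ fun p _ =>
      hwm.comp (measurable_const.sub (RegularGaugeGroup.measurable_reTr.comp
        (Missing.measurable_plaqHol (G := Matrix.specialUnitaryGroup (Fin N) ℂ) p)))
  have hWb : ∀ U : GaugeField P 0 (Matrix.specialUnitaryGroup (Fin N) ℂ), |∏ p : Plaq P 0, w (1 - reTr (GaugeField.plaqHol U p))| ≤ K ^ (Finset.univ : Finset (Plaq P 0)).card := fun U => by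
    rw [Finset.abs_prod, ← Finset.prod_const]
    exact Finset.prod_le_prod (fun p _ => abs_nonneg _) fun p _ => by rw [abs_of_nonneg (hw0 _)]; exact hK _
  have hint : ∀ (X : GaugeField P 0 (Matrix.specialUnitaryGroup (Fin N) ℂ) → ℝ) (CX : ℝ), Measurable X → (∀ U, |X U| ≤ CX) →
      Integrable (fun U => X U * (∏ p : Plaq P 0, w (1 - reTr (GaugeField.plaqHol U p))) * Missing.boltzmann P β U) (fieldMeasure P 0 (Matrix.specialUnitaryGroup (Fin N) ℂ)) := by
    intro X CX hXm hXb
    refine Missing.integrable_mul_boltzmann RegularGaugeGroup.measurable_reTr hβ (hXm.mul hWm)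
      (C := CX * K ^ (Finset.univ : Finset (Plaq P 0)).card) fun U => ?_
    rw [abs_mul]
    exact mul_le_mul (hXb U) (hWb U) (abs_nonneg _) ((abs_nonneg _).trans (hXb U))
  unfold Missing.expect
  refine div_le_div_of_nonneg_right (integral_mono (hint F CF hFm hCF) (hint G CG hGm hCG) fun U => ?_)
    (Missing.partitionFn_pos' P hβ).le
  exact mul_le_mul_of_nonneg_right (mul_le_mul_of_nonneg_right (hFG U) (Finset.prod_nonneg fun p _ => hw0 _))
    (Missing.boltzmann_pos P β U).le

/-- **THE CHESSBOARD BOUND FOR EXPONENTIAL MOMENTS OF CUBE ENERGIES** in the plaquette-weighted level-0 state of record (in particular in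
the small-field-RESTRICTED state, `w = 𝟙[· ≤ ε]`): for `β ≥ 0`, a non-negative bounded measurable weight `w` with `⟨∏_p w⟩ > 0`, `t ≥ 0` and
every set `S` of unit cubes of `T^{(0)}`,

  `⟨∏_{c ∈ S} e^{t E_c} · ∏_p w⟩ ∕ ⟨∏_p w⟩ ≤ (⟨∏_{c} e^{t E_c} · ∏_p w⟩ ∕ ⟨∏_p w⟩)^{#S ∕ N₀^d}`,  `E_c(U) = Σ_{p ⊂ [c, c+1]^d} (1 − Re tr U(∂p))`

— LOCAL exponential moments of cube (hence plaquette) energies in the restricted state are controlled by the GLOBAL one, whose β-uniform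
bound is module 10c's restricted action moment.  Module 11a's `chessboard_of_covariant` for the cube-energy family (§4). [folklore] -/
theorem chessboard_exp_cubeEnergy (P : Params) {β : ℝ} (hβ : 0 ≤ β) {w : ℝ → ℝ} (hw0 : ∀ t, 0 ≤ w t) (hwm : Measurable w)
    (hwb : ∃ K : ℝ, ∀ t, w t ≤ K)
    (hW : 0 < Missing.expect (G := Matrix.specialUnitaryGroup (Fin N) ℂ) P β (fun U => ∏ p : Plaq P 0, w (1 - reTr (GaugeField.plaqHol U p))))
    {t : ℝ} (ht : 0 ≤ t) (S : Finset (BlockIdx P.d (P.sitesPerDir 0))) :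
    Missing.expect (G := Matrix.specialUnitaryGroup (Fin N) ℂ) P β
        (fun U => (∏ c ∈ S, Real.exp (t * (∑ p : Plaq P 0,
          if (∀ κ, p.src κ = c κ ∨ (κ ≠ p.μ ∧ κ ≠ p.ν ∧ p.src κ = c κ + 1)) then (1 - reTr (GaugeField.plaqHol U p)) else 0))) *
          ∏ p : Plaq P 0, w (1 - reTr (GaugeField.plaqHol U p))) /
      Missing.expect (G := Matrix.specialUnitaryGroup (Fin N) ℂ) P β (fun U => ∏ p : Plaq P 0, w (1 - reTr (GaugeField.plaqHol U p))) ≤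
    (Missing.expect (G := Matrix.specialUnitaryGroup (Fin N) ℂ) P β
        (fun U => (∏ c : BlockIdx P.d (P.sitesPerDir 0), Real.exp (t * (∑ p : Plaq P 0,
          if (∀ κ, p.src κ = c κ ∨ (κ ≠ p.μ ∧ κ ≠ p.ν ∧ p.src κ = c κ + 1)) then (1 - reTr (GaugeField.plaqHol U p)) else 0))) *
          ∏ p : Plaq P 0, w (1 - reTr (GaugeField.plaqHol U p))) /
      Missing.expect (G := Matrix.specialUnitaryGroup (Fin N) ℂ) P β (fun U => ∏ p : Plaq P 0, w (1 - reTr (GaugeField.plaqHol U p)))) ^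
      ((S.card : ℝ) / (P.sitesPerDir 0 : ℝ) ^ P.d) := by
  have hFm : ∀ c : BlockIdx P.d (P.sitesPerDir 0), Measurable fun U : GaugeField P 0 (Matrix.specialUnitaryGroup (Fin N) ℂ) =>
      Real.exp (t * (∑ p : Plaq P 0, if (∀ κ, p.src κ = c κ ∨ (κ ≠ p.μ ∧ κ ≠ p.ν ∧ p.src κ = c κ + 1)) then (1 - reTr (GaugeField.plaqHol U p)) else 0)) := fun c =>
    Real.measurable_exp.comp ((measurable_cubeEnergy c).const_mul t)
  have hF1le : ∀ (c : BlockIdx P.d (P.sitesPerDir 0)) (U : GaugeField P 0 (Matrix.specialUnitaryGroup (Fin N) ℂ)),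
      1 ≤ Real.exp (t * (∑ p : Plaq P 0, if (∀ κ, p.src κ = c κ ∨ (κ ≠ p.μ ∧ κ ≠ p.ν ∧ p.src κ = c κ + 1)) then (1 - reTr (GaugeField.plaqHol U p)) else 0)) := fun c U =>
    Real.one_le_exp (mul_nonneg ht (cubeEnergy_mem c U).1)
  have hFb : ∀ (c : BlockIdx P.d (P.sitesPerDir 0)) (U : GaugeField P 0 (Matrix.specialUnitaryGroup (Fin N) ℂ)),
      Real.exp (t * (∑ p : Plaq P 0, if (∀ κ, p.src κ = c κ ∨ (κ ≠ p.μ ∧ κ ≠ p.ν ∧ p.src κ = c κ + 1)) then (1 - reTr (GaugeField.plaqHol U p)) else 0)) ≤ Real.exp (t * (2 * Fintype.card (Plaq P 0))) := fun c U =>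
    Real.exp_le_exp.2 (mul_le_mul_of_nonneg_left (cubeEnergy_mem c U).2 ht)
  refine chessboard_of_covariant P hβ hw0 hwm hwb hW (fun c U => Real.exp (t * (∑ p : Plaq P 0, if (∀ κ, p.src κ = c κ ∨ (κ ≠ p.μ ∧ κ ≠ p.ν ∧ p.src κ = c κ + 1)) then (1 - reTr (GaugeField.plaqHol U p)) else 0))) hFm
    (fun c U => (Real.exp_pos _).le) ⟨_, hFb⟩ (fun a c U => ?_) (fun π c U => ?_) (fun c U => ?_) (fun c hc => ?_) ?_ S
  · rw [cubeEnergy_translate]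
  · rw [cubeEnergy_permute]
  · rw [cubeEnergy_negReflect]
  · exact fun U V hUV => congrArg (fun x => Real.exp (t * x)) (posHalfSupported_cubeEnergy hc U V hUV)
  · -- `⟨∏_c e^{tE_c} ∏w⟩ ≥ ⟨∏w⟩ > 0`
    refine hW.trans_le ?_
    have h := expect_mul_prod_mono (N := N) P hβ hw0 hwm hwb (F := fun _ => (1 : ℝ))
      (G := fun U => ∏ c : BlockIdx P.d (P.sitesPerDir 0), Real.exp (t * (∑ p : Plaq P 0, if (∀ κ, p.src κ = c κ ∨ (κ ≠ p.μ ∧ κ ≠ p.ν ∧ p.src κ = c κ + 1)) then (1 - reTr (GaugeField.plaqHol U p)) else 0))) measurable_const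
      (Finset.measurable_prod _ fun c _ => hFm c) ⟨1, fun U => by simp⟩
      ⟨Real.exp (t * (2 * Fintype.card (Plaq P 0))) ^ (Finset.univ : Finset (BlockIdx P.d (P.sitesPerDir 0))).card, fun U => by
        rw [Finset.abs_prod, ← Finset.prod_const]
        exact Finset.prod_le_prod (fun c _ => abs_nonneg _) fun c _ => by
          rw [abs_of_nonneg (Real.exp_pos _).le]; exact hFb c U⟩
      (fun U => by
        have h := Finset.prod_le_prod (s := (Finset.univ : Finset (BlockIdx P.d (P.sitesPerDir 0))))
          (fun c _ => (zero_le_one : (0 : ℝ) ≤ 1)) (fun c _ => hF1le c U)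
        rwa [Finset.prod_const_one] at h)
    simpa only [one_mul] using h

end Main

end Summit.QuantumFields.YangMills.BalabanUVNodes.N20LCSRestrictedChessboard

end
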